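import Summits.CriticalPhenomena.CardyFormulaZ2.Theorems.CardyComplexConeParafermionToSLESixFamiliesDefs
import Summits.CriticalPhenomena.CardyFormulaZ2.Theorems.CardyComplexConeParafermionToSLESixFamiliesLimitSource
import Literature.Probability.RandomPlanarGeometry.DrivingProcessWeakLimitVarying
import Literature.Probability.RandomPlanarGeometry.CaratheodoryHalfPlaneProofs
import Literature.Probability.RandomPlanarGeometry.ObservableClockPassage
import Literature.Probability.Percolation.BondInterfaceMeasurability
import Literature.Probability.LatticeModels.FKIsingLatticeDataAssembly
import HarnessLib

/-!
# `SlitMartingaleData` from Kemppainen–Smirnov lattice data and the slit-observable approximation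

Route `CardyComplexCone` (sub-problem `CriticalPhenomena/CardyFormulaZ2`), crux
`Summit.CriticalPhenomena.CardyFormulaZ2.Theses.CardyComplexCone.ParafermionToSLESixFamilies`
(item stmt-CriticalPhenomena-11389), line `caratheodory-net-slit-uniformity`, stub
`stub_slitMartingaleData : IdentifiedLimit → CarrierEquicontinuity → UniformPrecompact →
SlitMartingaleData`. This file is the ASSEMBLY of that stub from two named inputs, in the shape
of the tree's FK-Ising template `LatticeModels.exists_observableMartingale_fkInterface_of_latticeData`
(`FKIsingLatticeDataAssembly.lean`, items (1)–(2) and (3)):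

* `PercKSBoxData` — step (4c) of the line card: Kemppainen–Smirnov lattice data for the bond
  interfaces of a discretisation FAMILY along positive admissible meshes `δ_k → 0`: Dobrushin
  domains `(D_k; a_k, b_k)` carrying the discrete interfaces with chordal uniformizing maps `φ_k`
  whose boundary extensions converge to that of the given `φ` ((U1) on the compacts of the closed
  half-plane, (U2) at infinity, `b_k → b`; for the polygonal face domains this is Pommerenke's
  kernel theorem, `MarkedDomain.exists_uniformizers_of_kernel`), and box tightness of the
  interfaces read through the `φ_k` (KS Prop. 3.2 / Thm. 3.9–3.10 from Condition G2, i.e. RSW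
  `rsw_half_holds` uniformly over discrete domains);
* `PercParaApprox` — steps (4a), (4b), (4d): for every such system of maps, the discrete
  martingale approximation `ParaMartingaleApprox` of the spin-`1/3` half-plane observable along the
  capacity driving processes `V^k = drivingFunction φ_k ∘ Literature.Probability.Percolation.bondInterfaceIn D (Λ δ_k)` (conditional
  twisted passage amplitude given the exploration prefix — the domain Markov property of
  `medialExploration` under the product measure —, compactness of fattened slit data,
  `IdentifiedLimit`, `CarrierEquicontinuity`, `UniformPrecompact`, capacity bookkeeping);
  `PercParaClockData` — the same in CLOCK form (item (3) of the FK template: per scale a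
  filtration, an adapted capacity clock, a variable `X` and a normalisation `c` with
  `‖c E[X | 𝒢_n]‖ ≤ C` and `‖c E[X | 𝒢_n] - paraObservableProcess V^k y θ_n‖ ≤ ε_k` off a small
  event), with `percParaApprox_of_clockData : PercParaClockData → PercParaApprox`
  (`Loewner.exists_discreteMartingaleData_of_clocks_of_bound`); in the orientation where the
  exploration runs from `a` to `b`, `𝒢` is the exploration filtration, `X` the twisted passage sum
  and `E[X | 𝒢_n]` the percolation slit expectation (`…PercDomainMarkov.lean`,
  `…PercClockBridge.lean`, `…PercDrivingLocality.lean`).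

`slitMartingaleData_of_percData : PercKSBoxData → PercParaApprox → SlitMartingaleData` is PROVED:
along the given meshes `u n → 0⁺` drop the finitely many non-positive / non-admissible ones
(`ZdDiscretisationFamily.eventually_isZdAdmissible`), read the interface laws
`Pc.map (Literature.Probability.Percolation.bondInterfaceIn D (Λ δ_k))` (weakly convergent to `ν`, `integral_map`), convert box
tightness to the laws (closed images of boxes, `isClosed_image_and_continuousOn_drivingPath`),
apply Kemppainen–Smirnov's theorem in approximating domains
(`ae_isLoewnerDescribable_and_tendstoInDistribution_drivingPath_varying`) and transport the
driving convergence back to `(BondConfig ℤ², Pc)` (`tendstoInDistribution_comp_of_map_eq`),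
re-index by the dropped prefix, and add the source clause
(`ae_source_eq_of_tendsto_bondInterfaceIn`, file `…LimitSource.lean`).
-/

noncomputable section

open scoped Topology NNReal ENNReal BoundedContinuousFunction
open Filter Set MeasureTheory Metric
open UpperHalfPlane (upperHalfPlaneSet)
open Literature.Probability Literature.Probability.LatticeModels Literature.Probability.Percolation
open Literature.Probability.RandomPlanarGeometry
open scoped Literature.Probability.RandomPlanarGeometry.PathBorel

namespace Summit.CriticalPhenomena.CardyFormulaZ2.Cruxes.ParafermionToSLESixFamilies.CaratheodoryNetSlitUniformity


/-! ### The two named inputs -/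

/-- **(4c) Kemppainen–Smirnov lattice data for bond-percolation discretisation families.** For
every Dobrushin domain `(D; a, b)`, discretisation family `Λ`, chordal uniformizing map `φ` of `D`
and sequence of positive admissible meshes `δ_k → 0`, there are Dobrushin domains `(D_k; a_k, b_k)`
with chordal uniformizing maps `φ_k` such that (1) the boundary extensions `Φ_k → Φ` converge
uniformly on `{0 ≤ im} ∩ closedBall 0 R` for every `R` and uniformly at infinity, and `b_k → b`
(the hypotheses `hU1`, `hU2`, `hb` of
`ae_isLoewnerDescribable_and_tendstoInDistribution_drivingPath_varying`; for the polygonal face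
domains of the data, `MarkedDomain.exists_uniformizers_of_kernel`), and (2) for every `ε > 0` one
Kemppainen–Smirnov box of Loewner pairs (moduli `δγ, δW > 0` of the capacity-parametrised
pull-back and of its driving term, transience profile `T`) carries `Pc`-mass `≥ 1 - ε` of the
interfaces `Literature.Probability.Percolation.bondInterfaceIn D (Λ δ_k)` read through `φ_k`, at every scale — KS Prop. 3.2 with
Thms. 3.9–3.10 for the family `(φ_k, Law(γ_{δ_k}))`, the output of Condition G2 (RSW on `ℤ²`,
`rsw_half_holds`, uniformly over the discrete domains). -/
def PercKSBoxData : Prop :=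
  ∀ (D : DobrushinDomain) (Λ : ℝ → DiscreteDobrushin), ZdDiscretisationFamily D Λ →
    ∀ φ : ConformalEquiv upperHalfPlaneSet D.carrier, D.IsChordalUniformizing φ →
    ∀ δs : ℕ → ℝ, (∀ k, 0 < δs k) → Tendsto δs atTop (𝓝 0) →
      (∀ k, (Λ (δs k)).IsZdAdmissible) →
    ∃ (Ds : ℕ → DobrushinDomain) (φs : ∀ k, ConformalEquiv upperHalfPlaneSet (Ds k).carrier),
      (∀ k, (Ds k).IsChordalUniformizing (φs k)) ∧
      (∀ R : ℝ, TendstoUniformlyOn (fun k ↦ (φs k).boundaryExtension) φ.boundaryExtension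
        atTop ({z : ℂ | 0 ≤ z.im} ∩ closedBall 0 R)) ∧
      (∀ ε : ℝ, 0 < ε → ∃ r : ℝ, ∀ᶠ k in atTop, ∀ z : ℂ, z ∈ {z : ℂ | 0 ≤ z.im} → r ≤ ‖z‖ →
        dist ((φs k).boundaryExtension z) ((Ds k).pt 1) ≤ ε) ∧
      Tendsto (fun k ↦ (Ds k).pt 1) atTop (𝓝 (D.pt 1)) ∧
      (∀ ε : ℝ≥0∞, 0 < ε → ∃ (δγ δW : ℕ → ℝ) (T : ℕ → ℝ≥0), (∀ j, 0 < δγ j) ∧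
        (∀ j, 0 < δW j) ∧
        ∀ k, Pc ((Literature.Probability.Percolation.bondInterfaceIn D (Λ (δs k))) ⁻¹'
          ((fun p ↦ compactifiedClass (φs k).boundaryExtension ((Ds k).pt 1) p.1) ''
            {p : C(ℝ≥0, ℂ) × C(ℝ≥0, ℝ) | p ∈ generatedPairs ∧
              p.1 ∈ Process.modulusSet ({0} : Set ℂ) δγ ∧
              p.2 ∈ Process.modulusSet ({0} : Set ℝ) δW ∧
              ∀ (j : ℕ) (t : ℝ≥0), T j ≤ t → (j : ℝ) ≤ ‖p.1 t‖})ᶜ) ≤ ε)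

/-- **(4a)+(4b)+(4d) The slit-observable martingale approximation through the discrete
uniformizing maps.** For every Dobrushin domain, discretisation family, chordal uniformizing map
`φ`, positive admissible meshes `δ_k → 0` and every system of Dobrushin domains `D_k` with chordal
uniformizing maps `φ_k` whose boundary extensions converge to that of `φ` ((U1), (U2), `b_k → b`)
AND through which the interfaces are box-tight (the output of `PercKSBoxData`; in particular at
every scale `Pc`-a.e. interface class is describable through `φ_k`, so that the driving function
below is not junk), the capacity driving processes `V^k_u(ω) = drivingFunction φ_k (Literature.Probability.Percolation.bondInterfaceIn D (Λ δ_k) ω) u`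
admit the discrete martingale approximation data `ParaMartingaleApprox V` of the spin-`1/3`
half-plane observable (the conditional twisted passage amplitude given the exploration prefix,
normalised, against `paraObservableProcess (V k) y` at the capacity stopping steps). This is the
research content of the line (domain Markov property of `medialExploration` under `Pc`,
admissible fattened slit data, Carathéodory compactness + `IdentifiedLimit` +
`CarrierEquicontinuity` + `UniformPrecompact`, capacity bookkeeping). -/
def PercParaApprox : Prop :=
  ∀ (D : DobrushinDomain) (Λ : ℝ → DiscreteDobrushin), ZdDiscretisationFamily D Λ →
    ∀ φ : ConformalEquiv upperHalfPlaneSet D.carrier, D.IsChordalUniformizing φ →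
    ∀ δs : ℕ → ℝ, (∀ k, 0 < δs k) → Tendsto δs atTop (𝓝 0) →
      (∀ k, (Λ (δs k)).IsZdAdmissible) →
    ∀ (Ds : ℕ → DobrushinDomain) (φs : ∀ k, ConformalEquiv upperHalfPlaneSet (Ds k).carrier),
      (∀ k, (Ds k).IsChordalUniformizing (φs k)) →
      (∀ R : ℝ, TendstoUniformlyOn (fun k ↦ (φs k).boundaryExtension) φ.boundaryExtension
        atTop ({z : ℂ | 0 ≤ z.im} ∩ closedBall 0 R)) →
      (∀ ε : ℝ, 0 < ε → ∃ r : ℝ, ∀ᶠ k in atTop, ∀ z : ℂ, z ∈ {z : ℂ | 0 ≤ z.im} → r ≤ ‖z‖ →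
        dist ((φs k).boundaryExtension z) ((Ds k).pt 1) ≤ ε) →
      Tendsto (fun k ↦ (Ds k).pt 1) atTop (𝓝 (D.pt 1)) →
      (∀ ε : ℝ≥0∞, 0 < ε → ∃ (δγ δW : ℕ → ℝ) (T : ℕ → ℝ≥0), (∀ j, 0 < δγ j) ∧
        (∀ j, 0 < δW j) ∧
        ∀ k, Pc ((Literature.Probability.Percolation.bondInterfaceIn D (Λ (δs k))) ⁻¹'
          ((fun p ↦ compactifiedClass (φs k).boundaryExtension ((Ds k).pt 1) p.1) ''
            {p : C(ℝ≥0, ℂ) × C(ℝ≥0, ℝ) | p ∈ generatedPairs ∧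
              p.1 ∈ Process.modulusSet ({0} : Set ℂ) δγ ∧
              p.2 ∈ Process.modulusSet ({0} : Set ℝ) δW ∧
              ∀ (j : ℕ) (t : ℝ≥0), T j ≤ t → (j : ℝ) ≤ ‖p.1 t‖})ᶜ) ≤ ε) →
      ParaMartingaleApprox (fun k u ω ↦ drivingFunction (φs k) (Literature.Probability.Percolation.bondInterfaceIn D (Λ (δs k)) ω) u)

/-- **(4a)+(4b)+(4d) in clock form** (item (3) of the FK template
`LatticeModels.exists_observableMartingale_fkInterface_of_latticeData`, with the spin-`1/3`
half-plane observable in place of the FK one): for every system `(D_k, φ_k)` as in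
`PercParaApprox` and every `y > 0`, `s < t < T(iy)`, there are `C` and `ε_k, Δ_k, η_k → 0` and,
at every scale, a filtration `𝒢` of `BondConfig ℤ²` (the exploration filtration
`explorationFiltration`), an adapted capacity clock `θ`, a step bound `M`, a variable `X` (the
twisted passage sum at a lattice edge near `φ_k(iy)`) and a normalisation `c` (`≍ δ_k^{-1/3}`, with
the anchoring phase and the `t`-independent factor `((φ⁻¹)′)^{-1/3}`) with
`‖c E[X | 𝒢_n]‖ ≤ C` a.e. for `n ≤ M` (`UniformPrecompact` over the slit data — by the domain
Markov property `E[X | 𝒢_n]` is the percolation slit expectation `percSlitExpectation`,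
`…PercDomainMarkov.lean`), a measurable event `bad` of probability `≤ η_k` off which the clock
starts below `Δ_k`, has increments `≤ Δ_k` and reaches `t` by step `M` (tightness), the driving
process `V^k = drivingFunction φ_k ∘ Literature.Probability.Percolation.bondInterfaceIn D (Λ δ_k)` revealed by step `M` and local for
`(𝒢, θ)` (`LoewnerTransformLocality.lean`), and the approximation
`‖c E[X | 𝒢_n] - paraObservableProcess V^k y (θ_n)‖ ≤ ε_k` for `n ≤ M`, `θ_n ≤ t + Δ_k`
(`IdentifiedLimit` + `CarrierEquicontinuity` + compactness of the fattened slit data). -/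
def PercParaClockData : Prop :=
  ∀ (D : DobrushinDomain) (Λ : ℝ → DiscreteDobrushin), ZdDiscretisationFamily D Λ →
    ∀ φ : ConformalEquiv upperHalfPlaneSet D.carrier, D.IsChordalUniformizing φ →
    ∀ δs : ℕ → ℝ, (∀ k, 0 < δs k) → Tendsto δs atTop (𝓝 0) →
      (∀ k, (Λ (δs k)).IsZdAdmissible) →
    ∀ (Ds : ℕ → DobrushinDomain) (φs : ∀ k, ConformalEquiv upperHalfPlaneSet (Ds k).carrier),
      (∀ k, (Ds k).IsChordalUniformizing (φs k)) →
      (∀ R : ℝ, TendstoUniformlyOn (fun k ↦ (φs k).boundaryExtension) φ.boundaryExtension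
        atTop ({z : ℂ | 0 ≤ z.im} ∩ closedBall 0 R)) →
      (∀ ε : ℝ, 0 < ε → ∃ r : ℝ, ∀ᶠ k in atTop, ∀ z : ℂ, z ∈ {z : ℂ | 0 ≤ z.im} → r ≤ ‖z‖ →
        dist ((φs k).boundaryExtension z) ((Ds k).pt 1) ≤ ε) →
      Tendsto (fun k ↦ (Ds k).pt 1) atTop (𝓝 (D.pt 1)) →
      (∀ ε : ℝ≥0∞, 0 < ε → ∃ (δγ δW : ℕ → ℝ) (T : ℕ → ℝ≥0), (∀ j, 0 < δγ j) ∧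
        (∀ j, 0 < δW j) ∧
        ∀ k, Pc ((Literature.Probability.Percolation.bondInterfaceIn D (Λ (δs k))) ⁻¹'
          ((fun p ↦ compactifiedClass (φs k).boundaryExtension ((Ds k).pt 1) p.1) ''
            {p : C(ℝ≥0, ℂ) × C(ℝ≥0, ℝ) | p ∈ generatedPairs ∧
              p.1 ∈ Process.modulusSet ({0} : Set ℂ) δγ ∧
              p.2 ∈ Process.modulusSet ({0} : Set ℝ) δW ∧
              ∀ (j : ℕ) (t : ℝ≥0), T j ≤ t → (j : ℝ) ≤ ‖p.1 t‖})ᶜ) ≤ ε) →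
      ∀ y : ℝ, 0 < y → ∀ s t : ℝ≥0, s < t → t < Loewner.cdhksTime y →
        ∃ (C : ℝ) (ε Δ η : ℕ → ℝ≥0), Tendsto ε atTop (𝓝 0) ∧ Tendsto Δ atTop (𝓝 0) ∧
          Tendsto η atTop (𝓝 0) ∧
          ∀ k, ∃ (𝒢 : Filtration ℕ (inferInstance : MeasurableSpace (BondConfig (Site 2))))
            (θ : ℕ → BondConfig (Site 2) → ℝ≥0) (M : ℕ) (X : BondConfig (Site 2) → ℂ) (c : ℂ)
            (bad : Set (BondConfig (Site 2))),
            Adapted 𝒢 θ ∧ (∀ ω, ω ∉ bad → θ 0 ω ≤ Δ k) ∧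
            (∀ u, Measurable[𝒢 M] fun ω ↦
              drivingFunction (φs k) (Literature.Probability.Percolation.bondInterfaceIn D (Λ (δs k)) ω) u) ∧
            (∀ n u, Measurable[𝒢 n] ({ω | u ≤ θ n ω}.indicator fun ω ↦
              drivingFunction (φs k) (Literature.Probability.Percolation.bondInterfaceIn D (Λ (δs k)) ω) u)) ∧
            (∀ᵐ ω ∂Pc, ∀ n, n ≤ M → ‖c * Pc[X|𝒢 n] ω‖ ≤ C) ∧
            MeasurableSet bad ∧ Pc bad ≤ η k ∧
            (∀ ω, ω ∉ bad → ∃ n ≤ M, t ≤ θ n ω) ∧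
            (∀ ω, ω ∉ bad → ∀ n, n < M → θ (n + 1) ω ≤ θ n ω + Δ k) ∧
            (∀ᵐ ω ∂Pc, ω ∉ bad → ∀ n, n ≤ M → θ n ω ≤ t + Δ k →
              ‖c * Pc[X|𝒢 n] ω -
                paraObservableProcess (fun u ω ↦ drivingFunction (φs k)
                  (Literature.Probability.Percolation.bondInterfaceIn D (Λ (δs k)) ω) u) y (θ n ω) ω‖ ≤ ε k)

/-- **Clock form ⇒ (D) form**: the capacity clocks and Doob martingales package into the
discrete-martingale approximation data `ParaMartingaleApprox` (the tree's
`Loewner.exists_discreteMartingaleData_of_clocks_of_bound` for the targets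
`N^y(V^k) = paraObservableProcess (V k) y`). -/
theorem percParaApprox_of_clockData : PercParaClockData → PercParaApprox := by
  intro h D Λ hΛ φ hφ δs hδpos hδ0 hδadm Ds φs hφs hU1 hU2 hb hbox y hy s t hst htT
  obtain ⟨C, ε, Δ, η, hε, hΔ, hη, hk⟩ :=
    h D Λ hΛ φ hφ δs hδpos hδ0 hδadm Ds φs hφs hU1 hU2 hb hbox y hy s t hst htT
  haveI : ∀ k : ℕ, IsProbabilityMeasure ((fun _ : ℕ ↦ Pc) k) := fun _ ↦ by
    dsimp only [Pc]; infer_instance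
  exact Loewner.exists_discreteMartingaleData_of_clocks_of_bound (P := fun _ ↦ Pc)
    (fun k u ω ↦ paraObservableProcess
      (fun u ω ↦ drivingFunction (φs k) (Literature.Probability.Percolation.bondInterfaceIn D (Λ (δs k)) ω) u) y u ω) hst hε hΔ hη hk

/-! ### Tools -/

/-- **Re-indexing convergence in distribution by a delay**: if `X_k → Z` in distribution along
`atTop` on a constant probability space, so does `k ↦ X_{k - N}`. -/
theorem tendstoInDistribution_sub {E Ω Ω' : Type*} {m : MeasurableSpace Ω} {P : Measure Ω}
    [IsProbabilityMeasure P] {m' : MeasurableSpace Ω'} {μ' : Measure Ω'} [IsProbabilityMeasure μ']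
    [TopologicalSpace E] [MeasurableSpace E] [OpensMeasurableSpace E]
    {X : ℕ → Ω → E} {Z : Ω' → E}
    (h : TendstoInDistribution X atTop Z (fun _ => P) μ') (N : ℕ) :
    TendstoInDistribution (fun k ↦ X (k - N)) atTop Z (fun _ => P) μ' := by
  refine ⟨fun k ↦ h.forall_aemeasurable (k - N), h.aemeasurable_limit, ?_⟩
  exact h.tendsto.comp (tendsto_sub_atTop_nat N)

/-- `ParaMartingaleApprox` is stable under delaying the index. -/
theorem paraMartingaleApprox_sub {V : ℕ → ℝ≥0 → BondConfig (Site 2) → ℝ}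
    (h : ParaMartingaleApprox V) (N : ℕ) : ParaMartingaleApprox (fun k ↦ V (k - N)) := by
  intro y hy s t hst htT
  obtain ⟨C', ε, Δ, η, hε, hΔ, hη, hk⟩ := h y hy s t hst htT
  refine ⟨C', fun k ↦ ε (k - N), fun k ↦ Δ (k - N), fun k ↦ η (k - N),
    hε.comp (tendsto_sub_atTop_nat N), hΔ.comp (tendsto_sub_atTop_nat N),
    hη.comp (tendsto_sub_atTop_nat N), fun k ↦ hk (k - N)⟩

/-! ### The assembly -/

/-- **`SlitMartingaleData` from the Kemppainen–Smirnov lattice data and the slit-observable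
approximation** (registered glue of the skeleton; the bond-percolation twin of
`LatticeModels.exists_observableMartingale_fkInterface_of_latticeData`). Given `PercKSBoxData`
and `PercParaApprox`: for a discretisation family `Λ` of `(D; a, b)`, meshes `u n → 0⁺` and a
probability measure `ν` with `Law(Literature.Probability.Percolation.bondInterfaceIn D (Λ (u n))) → ν` weakly, fix a chordal
uniformizing map `φ` (`MarkedDomain.exists_isChordalUniformizing_holds`); drop the first `N`
meshes so that the remaining ones are positive and admissible
(`ZdDiscretisationFamily.eventually_isZdAdmissible`); the interface laws along them still converge
to `ν` (`integral_map`); `PercKSBoxData` gives domains and maps `(D_k, φ_k)` with (U1), (U2),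
`b_k → b` and box tightness, converted to the laws through the closedness of the images of the
boxes (`isClosed_image_and_continuousOn_drivingPath`, `isCompact_pairBox`); Kemppainen–Smirnov in
approximating domains (`ae_isLoewnerDescribable_and_tendstoInDistribution_drivingPath_varying`)
yields `ν`-a.e. describability through `φ` and convergence in distribution of the discrete driving
paths, transported to `(BondConfig ℤ², Pc)` (`tendstoInDistribution_comp_of_map_eq`) and delayed
back to the original index (`tendstoInDistribution_sub`, `paraMartingaleApprox_sub`);
`PercParaApprox` is the martingale clause; the source clause is
`ae_source_eq_of_tendsto_bondInterfaceIn`. -/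
theorem slitMartingaleData_of_percData : PercKSBoxData → PercParaApprox → SlitMartingaleData := by
  intro hKS hPA D Λ hΛ u hu ν hν hlim
  -- a chordal uniformizing map of the limit domain
  obtain ⟨φ, hφ⟩ := MarkedDomain.exists_isChordalUniformizing_holds D
  -- the source clause
  have hsrc : ∀ᵐ c ∂ν, c.source = D.pt 0 :=
    ae_source_eq_of_tendsto_bondInterfaceIn D Λ hΛ u hu ν hlim
  -- drop the non-positive / non-admissible meshes
  have hpos : ∀ᶠ n in atTop, u n ∈ Ioi (0 : ℝ) := hu.eventually eventually_mem_nhdsWithin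
  have hadm : ∀ᶠ n in atTop, (Λ (u n)).IsZdAdmissible := hu.eventually hΛ.eventually_isZdAdmissible
  obtain ⟨N, hN⟩ := (hpos.and hadm).exists_forall_of_atTop
  set δs : ℕ → ℝ := fun k ↦ u (k + N) with hδs
  have hδpos : ∀ k, 0 < δs k := fun k ↦ (hN _ (Nat.le_add_left _ _)).1
  have hδadm : ∀ k, (Λ (δs k)).IsZdAdmissible := fun k ↦ (hN _ (Nat.le_add_left _ _)).2
  have hδ0 : Tendsto δs atTop (𝓝 0) :=
    (tendsto_nhds_of_tendsto_nhdsWithin hu).comp (tendsto_add_atTop_nat N)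
  -- the lattice data along `δs`
  obtain ⟨Ds, φs, hφs, hU1, hU2, hb, hbox⟩ := hKS D Λ hΛ φ hφ δs hδpos hδ0 hδadm
  have hpara := hPA D Λ hΛ φ hφ δs hδpos hδ0 hδadm Ds φs hφs hU1 hU2 hb hbox
  -- the interface laws along `δs`
  set Y : ∀ k : ℕ, BondConfig (Site 2) → CurveClass ℂ := fun k ↦ Literature.Probability.Percolation.bondInterfaceIn D (Λ (δs k))
    with hYdef
  have hYm : ∀ k, AEMeasurable (Y k) Pc := fun k ↦ (measurable_bondInterfaceIn D _).aemeasurable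
  set μs : ℕ → Measure (CurveClass ℂ) := fun k ↦ Pc.map (Y k) with hμsdef
  haveI hμsP : ∀ k, IsProbabilityMeasure (μs k) := fun k ↦
    Measure.isProbabilityMeasure_map (hYm k)
  have hlim' : ∀ f : CurveClass ℂ →ᵇ ℝ,
      Tendsto (fun k ↦ ∫ c, f c ∂μs k) atTop (𝓝 (∫ c, f c ∂ν)) := by
    intro f
    have hint : ∀ k, ∫ c, f c ∂μs k = ∫ ω, f (Y k ω) ∂Pc := fun k ↦
      integral_map (hYm k) f.continuous.aestronglyMeasurable
    simp_rw [hint]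
    exact (hlim f).comp (tendsto_add_atTop_nat N)
  -- box tightness, in the form of laws
  have hbox' : ∀ ε : ℝ≥0∞, 0 < ε → ∃ (δγ δW : ℕ → ℝ) (T : ℕ → ℝ≥0), (∀ j, 0 < δγ j) ∧
      (∀ j, 0 < δW j) ∧
      ∀ k, μs k ((fun p ↦ compactifiedClass (φs k).boundaryExtension ((Ds k).pt 1) p.1) ''
        {p : C(ℝ≥0, ℂ) × C(ℝ≥0, ℝ) | p ∈ generatedPairs ∧
          p.1 ∈ Process.modulusSet ({0} : Set ℂ) δγ ∧ p.2 ∈ Process.modulusSet ({0} : Set ℝ) δW ∧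
          ∀ (j : ℕ) (t : ℝ≥0), T j ≤ t → (j : ℝ) ≤ ‖p.1 t‖})ᶜ ≤ ε := by
    intro ε hε
    obtain ⟨δγ, δW, T, hδγ, hδW, hall⟩ := hbox ε hε
    refine ⟨δγ, δW, T, hδγ, hδW, fun k ↦ ?_⟩
    set 𝒦 : Set (C(ℝ≥0, ℂ) × C(ℝ≥0, ℝ)) := {p | p ∈ generatedPairs ∧
      p.1 ∈ Process.modulusSet ({0} : Set ℂ) δγ ∧ p.2 ∈ Process.modulusSet ({0} : Set ℝ) δW ∧
      ∀ (j : ℕ) (t : ℝ≥0), T j ≤ t → (j : ℝ) ≤ ‖p.1 t‖} with h𝒦def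
    have h𝒦 : IsCompact 𝒦 := isCompact_pairBox hδγ hδW T
    have hgen : 𝒦 ⊆ generatedPairs := fun p hp ↦ hp.1
    have htrans : ∀ r : ℝ, ∃ T' : ℝ≥0, ∀ p ∈ 𝒦, ∀ t, T' ≤ t → r ≤ ‖p.1 t‖ := fun r ↦
      ⟨T ⌈r⌉₊, fun p hp t ht ↦ (Nat.le_ceil r).trans (hp.2.2.2 _ t ht)⟩
    have hclosed : IsClosed ((fun p ↦ compactifiedClass (φs k).boundaryExtension ((Ds k).pt 1)
        p.1) '' 𝒦) :=
      (isClosed_image_and_continuousOn_drivingPath (hφs k) h𝒦 hgen htrans).2.2.1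
    change (Pc.map (Y k)) _ ≤ ε
    rw [Measure.map_apply_of_aemeasurable (hYm k) hclosed.measurableSet.compl]
    exact hall k
  -- Kemppainen–Smirnov in approximating domains: describability and driving convergence
  obtain ⟨hdesc, hTD⟩ :=
    ae_isLoewnerDescribable_and_tendstoInDistribution_drivingPath_varying hφ hφs hU1 hU2 hb
      hlim' hbox'
  -- transport of the driving-process convergence to the lattice probability space
  have hTD' := tendstoInDistribution_comp_of_map_eq (P := fun _ ↦ Pc) hTD Y hYm fun k ↦ rfl
  -- delay back to the original index
  set V : ℕ → ℝ≥0 → BondConfig (Site 2) → ℝ :=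
    fun k u ω ↦ drivingFunction (φs (k - N)) (Y (k - N) ω) u with hVdef
  have hVc : ∀ k ω, Continuous (V k · ω) := fun k ω ↦
    continuous_drivingFunction (φs (k - N)) (Y (k - N) ω)
  refine ⟨φ, hφ, hdesc, hsrc, V, hVc, ?_, ?_⟩
  · exact tendstoInDistribution_sub hTD' N
  · exact paraMartingaleApprox_sub hpara N

/-- **`SlitMartingaleData` from the Kemppainen–Smirnov lattice data and the clock form of the
slit-observable approximation** (`slitMartingaleData_of_percData` with
`percParaApprox_of_clockData`). -/
theorem slitMartingaleData_of_percClockData :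
    PercKSBoxData → PercParaClockData → SlitMartingaleData :=
  fun hKS hCl ↦ slitMartingaleData_of_percData hKS (percParaApprox_of_clockData hCl)

end Summit.CriticalPhenomena.CardyFormulaZ2.Cruxes.ParafermionToSLESixFamilies.CaratheodoryNetSlitUniformity

end
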